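import Summits.Ventures.CertifiedManyBodySolver.Upper.UMPSCellBondMatrix

/-!
# uMPS upper bound for the Hubbard chain, V: the cell bookkeeping (c)

HONEST FRAMING: first certified bounds; not a superconductivity verdict; every number certified or
labelled float.

Venture `Ventures/CertifiedManyBodySolver` (sr-mbsolver). Step (c) ("bookkeeping") of VAR's
`METHOD-umps.md` Theorem U1 for TWO-SITE CELLS (`FORMAT-umps1.md`, `ncell = 2`), on the tensor side:

* `gmixture` — the mixture functional `Σ_l ⟨ψ_l, O ψ_l⟩` (`ψ_l = mpsOpen (n+2) A e_l r`) for any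
  physical dimension `q` (the `q = 4` `mixture` of `UMPSBondBookkeeping` verbatim), its linearity,
  positivity and normalisation;
* `bookkeeping_cell_le` — **(c) for cells**: for `U ≥ 0`, a left-isometric `A : Fin 16 → M_D(ℂ)` and a
  unit `r`, on the open chain of `(n+2)·2` sites blocked into `n + 2` cells,
  `2 Re E(blockOp (toSpin H)) + U (2(n+2) − Re E(blockOp (toSpin N̂))) ≤ 2 Re E(bondSum n hh) + 8|t| + 6U`
  (`hh = cellBondMatrix t U`; the two sides differ by the terms of the LAST cell not covered by a bond:
  its intra-cell hopping, `≤ 4|t|` in modulus by `posSemidef_smul_one_sub_hopMatrix`, `2U ⟨n↑n↓⟩ ≤ 2U`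
  per site and `U ⟨1 − n⟩ ≤ U` per site).

Part VI (`Upper/UMPSCellEnergyBound.lean`) combines this with the telescoping dual bound
(`UMPSDualBound`, `q = 16`), the sector pairing (d) and the limit (e): `2 e(t,U) ≤ c`.
-/

noncomputable section

open Matrix Finset
open scoped ComplexOrder BigOperators Kronecker

namespace Summit.Ventures.CertifiedManyBodySolver.Upper

open Literature.MathematicalPhysics.QuantumLattice
open Literature.MathematicalPhysics.QuantumLattice.JordanWigner

/-! ### The mixture functional for a general physical dimension -/

variable {q D : ℕ}

/-- The expectation functional of the boundary-propagated MPS mixture on `n + 2` sites for physical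
dimension `q`: `gmixture A r n O = Σ_l ⟨ψ_l, O ψ_l⟩`, `ψ_l = mpsOpen (n+2) A e_l r`
(`mixture` of `UMPSBondBookkeeping` is the case `q = 4`). -/
def gmixture (A : MPSTensor q D) (r : Fin D → ℂ) (n : ℕ) (O : Op (Fin (n + 2)) q) : ℂ :=
  ∑ l : Fin D, star (mpsOpen (n + 2) A (Pi.single l 1) r) ⬝ᵥ (O *ᵥ mpsOpen (n + 2) A (Pi.single l 1) r)

/-- `mixture = gmixture` at `q = 4`. -/
theorem mixture_eq_gmixture (A : MPSTensor 4 D) (r : Fin D → ℂ) (n : ℕ) (O : Op (Fin (n + 2)) 4) :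
    mixture A r n O = gmixture A r n O := rfl

variable (A : MPSTensor q D) (r : Fin D → ℂ) (n : ℕ)

/-- Additivity. -/
theorem gmixture_add (O O' : Op (Fin (n + 2)) q) :
    gmixture A r n (O + O') = gmixture A r n O + gmixture A r n O' := by
  simp only [gmixture, Matrix.add_mulVec, dotProduct_add, Finset.sum_add_distrib]

/-- Homogeneity. -/
theorem gmixture_smul (c : ℂ) (O : Op (Fin (n + 2)) q) :
    gmixture A r n (c • O) = c * gmixture A r n O := by
  simp only [gmixture, Matrix.smul_mulVec, dotProduct_smul, smul_eq_mul, Finset.mul_sum]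

/-- Subtraction. -/
theorem gmixture_sub (O O' : Op (Fin (n + 2)) q) :
    gmixture A r n (O - O') = gmixture A r n O - gmixture A r n O' := by
  simp only [gmixture, Matrix.sub_mulVec, dotProduct_sub, Finset.sum_sub_distrib]

/-- Finite sums. -/
theorem gmixture_sum {ι : Type*} (s : Finset ι) (O : ι → Op (Fin (n + 2)) q) :
    gmixture A r n (∑ i ∈ s, O i) = ∑ i ∈ s, gmixture A r n (O i) := by
  simp only [gmixture, Matrix.sum_mulVec, dotProduct_sum]
  rw [Finset.sum_comm]

/-- Positivity: `Re gmixture(O) ≥ 0` for positive semidefinite `O`. -/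
theorem gmixture_re_nonneg {O : Op (Fin (n + 2)) q} (hO : O.PosSemidef) :
    0 ≤ (gmixture A r n O).re := by
  rw [gmixture, Complex.re_sum]
  exact Finset.sum_nonneg fun l _ => (Complex.nonneg_iff.1 (hO.dotProduct_mulVec_nonneg _)).1

variable {A r}

/-- Normalisation: for a left-isometric tensor and a unit boundary vector, `gmixture(1) = 1`. -/
theorem gmixture_one (hA : ∑ s, (A s)ᴴ * A s = 1) (hr : star r ⬝ᵥ r = 1) :
    gmixture A r n 1 = 1 := by
  simp only [gmixture, Matrix.one_mulVec]
  rw [sum_star_mpsOpen_dotProduct_mpsOpen_eq hA, hr]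

/-- `Re gmixture(onSite x M) ≤ 1` when `1 − M ⪰ 0` (normalised mixture). -/
theorem gmixture_onSite_re_le_one (hA : ∑ s, (A s)ᴴ * A s = 1) (hr : star r ⬝ᵥ r = 1)
    (x : Fin (n + 2)) {M : Matrix (Fin q) (Fin q) ℂ} (hM : (1 - M).PosSemidef) :
    (gmixture A r n (onSite x M)).re ≤ 1 := by
  have h := gmixture_re_nonneg A r n (onSite_posSemidef x hM)
  rw [onSite_sub', onSite_one', gmixture_sub, gmixture_one n hA hr, Complex.sub_re,
    Complex.one_re] at h
  linarith

/-- `Re gmixture(onSite x (1 − M)) = 1 − Re gmixture(onSite x M)` (normalised mixture). -/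
theorem gmixture_onSite_one_sub_re (hA : ∑ s, (A s)ᴴ * A s = 1) (hr : star r ⬝ᵥ r = 1)
    (x : Fin (n + 2)) (M : Matrix (Fin q) (Fin q) ℂ) :
    (gmixture A r n (onSite x (1 - M))).re = 1 - (gmixture A r n (onSite x M)).re := by
  rw [onSite_sub', onSite_one', gmixture_sub, gmixture_one n hA hr, Complex.sub_re, Complex.one_re]

/-- `Re gmixture(onSite x M) ≤ b` when `b·1 − M ⪰ 0` (normalised mixture). -/
theorem gmixture_onSite_re_le (hA : ∑ s, (A s)ᴴ * A s = 1) (hr : star r ⬝ᵥ r = 1)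
    (x : Fin (n + 2)) {M : Matrix (Fin q) (Fin q) ℂ} {b : ℝ}
    (hM : (((b : ℝ) : ℂ) • 1 - M).PosSemidef) :
    (gmixture A r n (onSite x M)).re ≤ b := by
  have h := gmixture_re_nonneg A r n (onSite_posSemidef x hM)
  rw [onSite_sub', onSite_smul', onSite_one', gmixture_sub, gmixture_smul, gmixture_one n hA hr,
    mul_one, Complex.sub_re, Complex.ofReal_re] at h
  linarith

/-! ### Step (c) for cells: bookkeeping -/

/-- **METHOD-umps §2(c) for two-site cells.** For `U ≥ 0`, a left-isometric `A : Fin 16 → M_D(ℂ)`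
and a unit boundary vector, on the open chain of `(n+2)·2` sites blocked into `n + 2` cells:
`2 Re E(blockOp (toSpin H)) + U (2(n+2) − Re E(blockOp (toSpin N̂))) ≤ 2 Re E(bondSum n hh) + 8|t| + 6U`. -/
theorem bookkeeping_cell_le {A : MPSTensor 16 D} {r : Fin D → ℂ} (n : ℕ)
    (hA : ∑ s, (A s)ᴴ * A s = 1) (hr : star r ⬝ᵥ r = 1) (t : ℝ) {U : ℝ} (hU : 0 ≤ U) :
    2 * (gmixture A r n (blockOp (n + 2)
          (toSpin (hamiltonian (SimpleGraph.pathGraph ((n + 2) * 2)) t U)))).re +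
        U * (2 * ((n : ℝ) + 2) -
          (gmixture A r n (blockOp (n + 2) (toSpin (totalNumber (Λ := Fin ((n + 2) * 2)))))).re) ≤
      2 * (gmixture A r n (bondSum n (cellBondMatrix t U))).re + 8 * |t| + 6 * U := by
  -- abbreviations for the one-cell expectations
  set h : Fin (n + 2) → ℝ := fun m => (gmixture A r n (onSite m (cellOp (hopMatrix t)))).re with hh
  set B : ℝ := (gmixture A r n (bondSum n (interHopMatrix t))).re with hB
  set dL : Fin (n + 2) → ℝ := fun m =>
    (gmixture A r n (onSite m (cellOp (siteDouble ⊗ₖ (1 : Matrix (Fin 4) (Fin 4) ℂ))))).re with hdL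
  set dR : Fin (n + 2) → ℝ := fun m =>
    (gmixture A r n (onSite m (cellOp ((1 : Matrix (Fin 4) (Fin 4) ℂ) ⊗ₖ siteDouble)))).re with hdR
  set nL : Fin (n + 2) → ℝ := fun m =>
    (gmixture A r n (onSite m (cellOp (siteTotalNumber ⊗ₖ (1 : Matrix (Fin 4) (Fin 4) ℂ))))).re with hnL
  set nR : Fin (n + 2) → ℝ := fun m =>
    (gmixture A r n (onSite m (cellOp ((1 : Matrix (Fin 4) (Fin 4) ℂ) ⊗ₖ siteTotalNumber)))).re with hnR
  -- one-cell bounds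
  have hh_le : ∀ m, h m ≤ 4 * |t| := fun m => by
    refine gmixture_onSite_re_le n hA hr m ?_
    rw [smul_one_sub_cellOp_kronecker_one, posSemidef_cellOp_iff]
    exact posSemidef_smul_one_sub_hopMatrix t
  have hdL_le : ∀ m, dL m ≤ 1 := fun m => by
    refine gmixture_onSite_re_le_one n hA hr m ?_
    rw [one_sub_cellOp_kronecker_one]
    exact posSemidef_cellOp_kronecker_one posSemidef_one_sub_siteDouble
  have hdR_le : ∀ m, dR m ≤ 1 := fun m => by
    refine gmixture_onSite_re_le_one n hA hr m ?_
    rw [one_sub_cellOp_one_kronecker]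
    exact posSemidef_cellOp_one_kronecker posSemidef_one_sub_siteDouble
  have hnL_ge : ∀ m, 0 ≤ nL m := fun m =>
    gmixture_re_nonneg A r n (onSite_posSemidef m (posSemidef_cellOp_kronecker_one posSemidef_siteTotalNumber))
  have hnR_ge : ∀ m, 0 ≤ nR m := fun m =>
    gmixture_re_nonneg A r n (onSite_posSemidef m (posSemidef_cellOp_one_kronecker posSemidef_siteTotalNumber))
  -- left-hand side in terms of the abbreviations
  have hH : (gmixture A r n (blockOp (n + 2)
      (toSpin (hamiltonian (SimpleGraph.pathGraph ((n + 2) * 2)) t U)))).re =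
      ∑ m, h m + B + (U * ∑ m, dL m + U * ∑ m, dR m) := by
    rw [blockOp_toSpin_hamiltonian_pathGraph, gmixture_add, gmixture_add, gmixture_add, gmixture_smul,
      gmixture_smul, gmixture_sum, gmixture_sum, gmixture_sum, Complex.add_re, Complex.add_re,
      Complex.add_re, Complex.re_ofReal_mul, Complex.re_ofReal_mul, Complex.re_sum, Complex.re_sum,
      Complex.re_sum]
  have hN : (gmixture A r n (blockOp (n + 2) (toSpin (totalNumber (Λ := Fin ((n + 2) * 2)))))).re =
      ∑ m, (nL m + nR m) := by
    rw [blockOp_toSpin_totalNumber, gmixture_sum, Complex.re_sum]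
    refine Finset.sum_congr rfl fun m _ => ?_
    rw [gmixture_add, Complex.add_re]
  -- right-hand side
  have hone_L : ∀ x : Fin (n + 2), (gmixture A r n (onSite x
      (cellOp ((1 - siteTotalNumber) ⊗ₖ (1 : Matrix (Fin 4) (Fin 4) ℂ))))).re = 1 - nL x := fun x => by
    rw [← one_sub_cellOp_kronecker_one, gmixture_onSite_one_sub_re n hA hr]
  have hone_R : ∀ x : Fin (n + 2), (gmixture A r n (onSite x
      (cellOp ((1 : Matrix (Fin 4) (Fin 4) ℂ) ⊗ₖ (1 - siteTotalNumber))))).re = 1 - nR x := fun x => by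
    rw [← one_sub_cellOp_one_kronecker, gmixture_onSite_one_sub_re n hA hr]
  have hcell : ∀ x : Fin (n + 2), (gmixture A r n (onSite x (cellOp (bondMatrix t U)))).re =
      h x + U * dL x + U / 2 * (1 - nL x) := fun x => by
    rw [onSite_cellOp_bondMatrix, gmixture_add, gmixture_add, gmixture_smul, gmixture_smul,
      Complex.add_re, Complex.add_re, Complex.re_ofReal_mul, Complex.re_ofReal_mul, hone_L]
  have hG : (gmixture A r n (bondSum n (cellBondMatrix t U))).re =
      ∑ x : Fin (n + 1), (h ⟨x, by omega⟩ + U * dL ⟨x, by omega⟩ + U / 2 * (1 - nL ⟨x, by omega⟩)) + B +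
        U * ∑ x : Fin (n + 1), dR ⟨x, by omega⟩ +
        U / 2 * ∑ x : Fin (n + 1), (1 - nR ⟨x, by omega⟩) := by
    rw [bondSum_cellBondMatrix, gmixture_add, gmixture_add, gmixture_add, gmixture_smul, gmixture_smul,
      gmixture_sum, gmixture_sum, gmixture_sum, Complex.add_re, Complex.add_re, Complex.add_re,
      Complex.re_ofReal_mul, Complex.re_ofReal_mul, Complex.re_sum, Complex.re_sum, Complex.re_sum]
    simp only [hcell, hone_R]
    rfl
  -- split the sums over all cells into the first `n + 1` cells and the last one
  have hsplit : ∀ f : Fin (n + 2) → ℝ, ∑ m, f m = ∑ x : Fin (n + 1), f ⟨x, by omega⟩ + f (Fin.last (n + 1)) := by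
    intro f
    rw [Fin.sum_univ_castSucc]
    rfl
  rw [hH, hN, hG]
  simp only [Finset.sum_add_distrib, Finset.sum_sub_distrib, ← Finset.mul_sum, Finset.sum_const,
    Finset.card_univ, Fintype.card_fin, nsmul_eq_mul]
  rw [hsplit h, hsplit dL, hsplit dR, hsplit nL, hsplit nR]
  push_cast
  have h1 := hh_le (Fin.last (n + 1))
  have h2 := mul_le_mul_of_nonneg_left (hdL_le (Fin.last (n + 1))) hU
  have h3 := mul_le_mul_of_nonneg_left (hdR_le (Fin.last (n + 1))) hU
  have h4 := mul_nonneg hU (hnL_ge (Fin.last (n + 1)))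
  have h5 := mul_nonneg hU (hnR_ge (Fin.last (n + 1)))
  nlinarith [h1, h2, h3, h4, h5, abs_nonneg t]

end Summit.Ventures.CertifiedManyBodySolver.Upper

end
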